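import Summits.RiemannHypothesis.RiemannHypothesis.Theorems.HandoffDodgerWitnessLink
import Summits.RiemannHypothesis.RiemannHypothesis.Theorems.HandoffDodgerNodePairing
import HarnessLib

/-!
# HANDOFF — the GENERATING FUNCTION of the dodger's edge weights (rh-explicit, track «HANDOFF», seat prove-2 gen9, ATTEMPT-16 Lemma A3 / ATTEMPT-18 §3 (R-3) D1 roadmap (γ))

HONEST FRAMING. Nothing here bears on the truth of RH; this is finite algebra. With the dodger's data (`K = N(T)`, nodes `z_ρ` of the killed
multiset `zerosBetween 0 T` with multiplicities `m(ρ)`, lattice `ν_k = ℓ_{k+1}²`, `P_T = dodgerPoly T`, edge weights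
`w_k = P_T(ν_k)/Π_{m≠k}(1 − ν_k/ν_m)` — the numbers in `Re F₀(b−σ) = c_∞/(2b) + (1/b)Σ_k w_k sin²(ℓ_{k+1}σ/2)`, HOME `HandoffDodgerEdgeValue.lean`),
gen8's Lagrange identity `HandoffDodgerLagrange.eval_div_prod_eq_one_sub_sum` at `u = 1/w` reads

  `Σ_k w_k/(1 − ν_k w) = 1 − c_∞ · Π_ρ(1 − z_ρ² w)^{m(ρ)} / Π_k(1 − ν_k w)`     (`sum_dodgerWeight_div_eq`, `w ≠ 0`, `ν_k w ≠ 1`),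

`c_∞ = Π_kν_k/Π_ρ(z_ρ²)^m = Π_kℓ_{k+1}²/Π_ρ‖z_ρ‖^{2m}` (node pairing). Its Taylor coefficients at `w = 0` are the MOMENTS `M_n = Σ_k w_kν_kⁿ = −c_∞·m_n`,
`m_n = [wⁿ]Π_ρ(1 − z_ρ²w)^m/Π_k(1 − ν_kw)`, through which ATTEMPT-16's Lemma D1 controls the collar profile
(`2b·F₀(b−σ) = c_∞Σ_n m_n(−σ²)ⁿ/(2n)!`). Also: the reversal identity `Π_i(1 − w⁻¹/a_i)^{m_i} = Π_i(1 − a_iw)^{m_i}·(−1)^{Σm}/(Π_i a_i^{m_i}·w^{Σm})`.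
No `sorry`, standard axioms, no definitions.

References: this track (ATTEMPT-16 §2 Lemma A3; ATTEMPT-18 §3).
-/

set_option linter.dupNamespace false

noncomputable section

open Complex Polynomial Finset
open scoped Real

namespace Summit.RiemannHypothesis.RiemannHypothesis.Theorems.Handoff

open Literature.NumberTheory.LFunctions Literature.NumberTheory.LFunctions.SchoenfeldBound

/-! ## Reversal of a product of linear factors -/

/-- One factor: `1 − w⁻¹/a = (1 − a·w)·(−(a·w)⁻¹)` for `a, w ≠ 0`. [folklore] -/
theorem one_sub_inv_div_eq {a w : ℂ} (ha : a ≠ 0) (hw : w ≠ 0) : 1 - w⁻¹ / a = (1 - a * w) * (-(a * w)⁻¹) := by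
  field_simp
  ring

/-- **Reversal**: `Π_{i∈s}(1 − w⁻¹/a_i)^{m_i} = (Π_{i∈s}(1 − a_iw)^{m_i}) · ((−1)^{Σm} · (Π_{i∈s}a_i^{m_i} · w^{Σm})⁻¹)`. [folklore] -/
theorem prod_one_sub_inv_div_pow_eq {ι : Type*} (s : Finset ι) (a : ι → ℂ) (m : ι → ℕ) {w : ℂ} (hw : w ≠ 0)
    (ha : ∀ i ∈ s, a i ≠ 0) :
    ∏ i ∈ s, (1 - w⁻¹ / a i) ^ m i =
      (∏ i ∈ s, (1 - a i * w) ^ m i) * ((-1) ^ (∑ i ∈ s, m i) * ((∏ i ∈ s, a i ^ m i) * w ^ (∑ i ∈ s, m i))⁻¹) := by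
  have h1 : ∏ i ∈ s, (1 - w⁻¹ / a i) ^ m i = ∏ i ∈ s, ((1 - a i * w) ^ m i * ((-1) ^ m i * ((a i ^ m i)⁻¹ * (w ^ m i)⁻¹))) := by
    refine Finset.prod_congr rfl fun i hi => ?_
    rw [one_sub_inv_div_eq (ha i hi) hw, mul_pow, neg_pow, mul_inv, mul_pow, inv_pow, inv_pow]
  rw [h1, Finset.prod_mul_distrib, Finset.prod_mul_distrib, Finset.prod_mul_distrib, Finset.prod_pow_eq_pow_sum,
    Finset.prod_inv_distrib, Finset.prod_inv_distrib, Finset.prod_pow_eq_pow_sum, mul_inv]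

/-! ## The generating function of the edge weights -/

/-- **The generating function of the dodger's edge weights.** For `b > 0`, any `T` (`K = N(T)`), and `w ≠ 0` with `ν_k w ≠ 1` for all `k`:
`Σ_k w_k/(1 − ν_k w) = 1 − (Π_kν_k/Π_ρ(z_ρ²)^m)·Π_ρ(1 − z_ρ²w)^m/Π_k(1 − ν_kw)`. [this track, ATTEMPT-16 Lemma A3; ATTEMPT-18 §3 D1 (γ)] -/
theorem sum_dodgerWeight_div_eq {b : ℝ} (hb : 0 < b) (T : ℝ) {w : ℂ} (hw : w ≠ 0)
    (hw1 : ∀ k : Fin (zetaZeroCount T), (((latticeFreq b (k.val + 1)) ^ 2 : ℝ) : ℂ) * w ≠ 1) :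
    ∑ k : Fin (zetaZeroCount T),
        (dodgerPoly T).eval (((latticeFreq b (k.val + 1)) ^ 2 : ℝ) : ℂ) /
            (∏ m ∈ univ.erase k, (1 - (((latticeFreq b (k.val + 1)) ^ 2 : ℝ) : ℂ) / (((latticeFreq b (m.val + 1)) ^ 2 : ℝ) : ℂ))) /
          (1 - (((latticeFreq b (k.val + 1)) ^ 2 : ℝ) : ℂ) * w) =
      1 - ((∏ k : Fin (zetaZeroCount T), (((latticeFreq b (k.val + 1)) ^ 2 : ℝ) : ℂ)) /
            ∏ ρ ∈ zerosBetween 0 T, (dodgerNode ρ ^ 2) ^ (riemannZetaZeroOrder ρ).toNat) *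
          ((∏ ρ ∈ zerosBetween 0 T, (1 - dodgerNode ρ ^ 2 * w) ^ (riemannZetaZeroOrder ρ).toNat) /
            ∏ k : Fin (zetaZeroCount T), (1 - (((latticeFreq b (k.val + 1)) ^ 2 : ℝ) : ℂ) * w)) := by
  set K : ℕ := zetaZeroCount T with hK
  have hν0 : ∀ k : Fin K, (((latticeFreq b (k.val + 1)) ^ 2 : ℝ) : ℂ) ≠ 0 := fun k => latticeFreq_sq_ne_zero hb.ne' K k
  have hνinj := latticeFreq_sq_injective hb K
  have hz : ∀ ρ ∈ zerosBetween 0 T, dodgerNode ρ ^ 2 ≠ 0 := fun ρ hρ =>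
    pow_ne_zero 2 (dodgerNode_ne_zero (((mem_zerosBetween le_rfl).1 hρ).2.2.2.1).ne')
  -- `u = 1/w` is off the nodes
  have hu : ∀ k : Fin K, w⁻¹ ≠ (((latticeFreq b (k.val + 1)) ^ 2 : ℝ) : ℂ) := by
    intro k h
    apply hw1 k
    rw [← h, mul_comm, mul_inv_cancel₀ hw]
  have hid := eval_div_prod_eq_one_sub_sum (fun k : Fin K => (((latticeFreq b (k.val + 1)) ^ 2 : ℝ) : ℂ)) hνinj hν0
    (dodgerPoly T) (dodgerPoly_eval_zero T) (hK ▸ natDegree_dodgerPoly_le T) w⁻¹ hu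
  beta_reduce at hid
  -- `u/(u − ν_k) = 1/(1 − ν_k w)`
  have hfrac : ∀ k : Fin K, w⁻¹ / (w⁻¹ - (((latticeFreq b (k.val + 1)) ^ 2 : ℝ) : ℂ)) =
      1 / (1 - (((latticeFreq b (k.val + 1)) ^ 2 : ℝ) : ℂ) * w) := by
    intro k
    have h1 : 1 - (((latticeFreq b (k.val + 1)) ^ 2 : ℝ) : ℂ) * w ≠ 0 := sub_ne_zero.2 (Ne.symm (hw1 k))
    have h2 : w⁻¹ - (((latticeFreq b (k.val + 1)) ^ 2 : ℝ) : ℂ) ≠ 0 := sub_ne_zero.2 (hu k)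
    field_simp
  simp only [hfrac, mul_one_div] at hid
  -- goal `S = 1 − B`, `hid : A = 1 − S`
  rw [eq_sub_iff_add_eq', ← eq_sub_iff_add_eq, ← hid]
  -- now `B = A = P(1/w)/Λ(1/w)`: reversal on both products
  rw [eval_dodgerPoly, prod_one_sub_inv_div_pow_eq _ _ _ hw hz]
  have hΛ := prod_one_sub_inv_div_pow_eq (univ : Finset (Fin K)) (fun k => (((latticeFreq b (k.val + 1)) ^ 2 : ℝ) : ℂ))
    (fun _ => 1) hw (fun k _ => hν0 k)
  simp only [pow_one, Finset.sum_const, card_univ, Fintype.card_fin, smul_eq_mul, mul_one] at hΛ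
  rw [hΛ, sum_zeroOrder_toNat_eq T, ← hK]
  -- cancel `(−1)^K` and `w^K`
  have hwK : w ^ K ≠ 0 := pow_ne_zero _ hw
  have h1K : ((-1 : ℂ)) ^ K ≠ 0 := pow_ne_zero _ (neg_ne_zero.2 one_ne_zero)
  have hPz : ∏ ρ ∈ zerosBetween 0 T, (dodgerNode ρ ^ 2) ^ (riemannZetaZeroOrder ρ).toNat ≠ 0 :=
    Finset.prod_ne_zero_iff.2 fun ρ hρ => pow_ne_zero _ (hz ρ hρ)
  have hPν : ∏ k : Fin K, (((latticeFreq b (k.val + 1)) ^ 2 : ℝ) : ℂ) ≠ 0 :=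
    Finset.prod_ne_zero_iff.2 fun k _ => hν0 k
  have hDw : ∏ k : Fin K, (1 - (((latticeFreq b (k.val + 1)) ^ 2 : ℝ) : ℂ) * w) ≠ 0 :=
    Finset.prod_ne_zero_iff.2 fun k _ => sub_ne_zero.2 (Ne.symm (hw1 k))
  field_simp
  congr 1
  exact Finset.prod_congr rfl fun ρ _ => by ring

/-- The same with the REAL constant `c_∞ = Π_kℓ_{k+1}²/Π_ρ‖z_ρ‖^{2m}` of the cost theorem (node pairing). [this track, ATTEMPT-18 §3 D1 (γ)] -/
theorem sum_dodgerWeight_div_eq_ofReal {b : ℝ} (hb : 0 < b) (T : ℝ) {w : ℂ} (hw : w ≠ 0)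
    (hw1 : ∀ k : Fin (zetaZeroCount T), (((latticeFreq b (k.val + 1)) ^ 2 : ℝ) : ℂ) * w ≠ 1) :
    ∑ k : Fin (zetaZeroCount T),
        (dodgerPoly T).eval (((latticeFreq b (k.val + 1)) ^ 2 : ℝ) : ℂ) /
            (∏ m ∈ univ.erase k, (1 - (((latticeFreq b (k.val + 1)) ^ 2 : ℝ) : ℂ) / (((latticeFreq b (m.val + 1)) ^ 2 : ℝ) : ℂ))) /
          (1 - (((latticeFreq b (k.val + 1)) ^ 2 : ℝ) : ℂ) * w) =
      1 - (((∏ k ∈ Finset.range (zetaZeroCount T), (latticeFreq b (k + 1)) ^ 2) /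
              ∏ ρ ∈ zerosBetween 0 T, ‖dodgerNode ρ‖ ^ (2 * (riemannZetaZeroOrder ρ).toNat) : ℝ) : ℂ) *
          ((∏ ρ ∈ zerosBetween 0 T, (1 - dodgerNode ρ ^ 2 * w) ^ (riemannZetaZeroOrder ρ).toNat) /
            ∏ k : Fin (zetaZeroCount T), (1 - (((latticeFreq b (k.val + 1)) ^ 2 : ℝ) : ℂ) * w)) := by
  rw [sum_dodgerWeight_div_eq hb T hw hw1, prod_dodgerNode_sq_pow_eq T,
    ← Fin.prod_univ_eq_prod_range (fun k => (latticeFreq b (k + 1)) ^ 2) (zetaZeroCount T)]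
  push_cast
  rfl

/-! ## Merged part: HANDOFF — the MOMENTS of the dodger's edge weights and their TRIANGULAR RECURSION (rh-explicit, track «HANDOFF», seat prove-2 gen9, ATTEMPT-18 §3 (R-3) D1 roadmap (α)/(γ))

(Originally a separate file of this track; its module docstring is kept with the HOME copy. Nothing here bears on the truth of RH.) -/

/-! ## Definitions -/

/-- The `k`-th EDGE WEIGHT of the dodger: `w_k = P_T(ν_k)/Π_{m≠k}(1 − ν_k/ν_m)`, `ν_k = ℓ_{k+1}²`. [this track, ATTEMPT-16 §2] -/
def dodgerWeight (b T : ℝ) (k : Fin (zetaZeroCount T)) : ℂ :=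
  (dodgerPoly T).eval (((latticeFreq b (k.val + 1)) ^ 2 : ℝ) : ℂ) /
    ∏ m ∈ univ.erase k, (1 - (((latticeFreq b (k.val + 1)) ^ 2 : ℝ) : ℂ) / (((latticeFreq b (m.val + 1)) ^ 2 : ℝ) : ℂ))

/-- The `n`-th MOMENT of the edge weights: `M_n = Σ_k w_k ν_kⁿ`. [this track, ATTEMPT-18 §3 D1 (α)] -/
def dodgerMoment (b T : ℝ) (n : ℕ) : ℂ :=
  ∑ k : Fin (zetaZeroCount T), dodgerWeight b T k * (((latticeFreq b (k.val + 1)) ^ 2 : ℝ) : ℂ) ^ n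

/-- The REVERSED lattice polynomial `Λ̃(X) = Π_k(1 − ν_kX)`. [this track, ATTEMPT-18 §3 D1 (γ)] -/
def latticeRevPoly (b T : ℝ) : ℂ[X] :=
  ∏ k : Fin (zetaZeroCount T), (1 - C (((latticeFreq b (k.val + 1)) ^ 2 : ℝ) : ℂ) * X)

/-- `Λ̃^{(k)}(X) = Π_{m≠k}(1 − ν_mX)`. [this track, ATTEMPT-18 §3 D1 (γ)] -/
def latticeRevPolyErase (b T : ℝ) (k : Fin (zetaZeroCount T)) : ℂ[X] :=
  ∏ m ∈ univ.erase k, (1 - C (((latticeFreq b (m.val + 1)) ^ 2 : ℝ) : ℂ) * X)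

/-- The REVERSED node polynomial `P̃(X) = Π_ρ(1 − z_ρ²X)^{m(ρ)}`. [this track, ATTEMPT-18 §3 D1 (γ)] -/
def nodeRevPoly (T : ℝ) : ℂ[X] :=
  ∏ ρ ∈ zerosBetween 0 T, (1 - C (dodgerNode ρ ^ 2) * X) ^ (riemannZetaZeroOrder ρ).toNat

/-- The complex constant `Π_kν_k/Π_ρ(z_ρ²)^{m}` (`= c_∞` by `prod_dodgerNode_sq_pow_eq`). [this track, ATTEMPT-16 §2] -/
def dodgerCinfC (b T : ℝ) : ℂ :=
  (∏ k : Fin (zetaZeroCount T), (((latticeFreq b (k.val + 1)) ^ 2 : ℝ) : ℂ)) /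
    ∏ ρ ∈ zerosBetween 0 T, (dodgerNode ρ ^ 2) ^ (riemannZetaZeroOrder ρ).toNat

/-! ## Evaluations -/

/-- `Λ̃(w) = Π_k(1 − ν_kw)`. [folklore] -/
theorem eval_latticeRevPoly (b T : ℝ) (w : ℂ) :
    (latticeRevPoly b T).eval w = ∏ k : Fin (zetaZeroCount T), (1 - (((latticeFreq b (k.val + 1)) ^ 2 : ℝ) : ℂ) * w) := by
  unfold latticeRevPoly
  rw [eval_prod]
  exact Finset.prod_congr rfl fun k _ => by simp

/-- `Λ̃^{(k)}(w) = Π_{m≠k}(1 − ν_mw)`. [folklore] -/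
theorem eval_latticeRevPolyErase (b T : ℝ) (k : Fin (zetaZeroCount T)) (w : ℂ) :
    (latticeRevPolyErase b T k).eval w = ∏ m ∈ univ.erase k, (1 - (((latticeFreq b (m.val + 1)) ^ 2 : ℝ) : ℂ) * w) := by
  unfold latticeRevPolyErase
  rw [eval_prod]
  exact Finset.prod_congr rfl fun m _ => by simp

/-- `P̃(w) = Π_ρ(1 − z_ρ²w)^{m}`. [folklore] -/
theorem eval_nodeRevPoly (T : ℝ) (w : ℂ) :
    (nodeRevPoly T).eval w = ∏ ρ ∈ zerosBetween 0 T, (1 - dodgerNode ρ ^ 2 * w) ^ (riemannZetaZeroOrder ρ).toNat := by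
  unfold nodeRevPoly
  rw [eval_prod]
  exact Finset.prod_congr rfl fun ρ _ => by simp

/-- `Λ̃ = (1 − ν_kX)·Λ̃^{(k)}`. [folklore] -/
theorem latticeRevPoly_eq_mul (b T : ℝ) (k : Fin (zetaZeroCount T)) :
    latticeRevPoly b T = (1 - C (((latticeFreq b (k.val + 1)) ^ 2 : ℝ) : ℂ) * X) * latticeRevPolyErase b T k := by
  unfold latticeRevPoly latticeRevPolyErase
  rw [← Finset.mul_prod_erase _ _ (mem_univ k)]

/-- `c_∞` (complex form) is the real cost-theorem constant. [this track, ATTEMPT-18 (D-3)] -/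
theorem dodgerCinfC_eq_ofReal (b T : ℝ) :
    dodgerCinfC b T = (((∏ k ∈ Finset.range (zetaZeroCount T), (latticeFreq b (k + 1)) ^ 2) /
        ∏ ρ ∈ zerosBetween 0 T, ‖dodgerNode ρ‖ ^ (2 * (riemannZetaZeroOrder ρ).toNat) : ℝ) : ℂ) := by
  unfold dodgerCinfC
  rw [prod_dodgerNode_sq_pow_eq T, ← Fin.prod_univ_eq_prod_range (fun k => (latticeFreq b (k + 1)) ^ 2) (zetaZeroCount T)]
  push_cast
  rfl

/-! ## The reversed Lagrange identity as a polynomial identity -/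

/-- Pointwise, off a finite set: `Σ_k w_k·Λ̃^{(k)}(w) = Λ̃(w) − c_∞·P̃(w)`. [this track, ATTEMPT-18 §3 D1 (γ)] -/
theorem sum_dodgerWeight_mul_eval {b : ℝ} (hb : 0 < b) (T : ℝ) {w : ℂ} (hw : w ≠ 0)
    (hw1 : ∀ k : Fin (zetaZeroCount T), (((latticeFreq b (k.val + 1)) ^ 2 : ℝ) : ℂ) * w ≠ 1) :
    ∑ k : Fin (zetaZeroCount T), dodgerWeight b T k * (latticeRevPolyErase b T k).eval w =
      (latticeRevPoly b T).eval w - dodgerCinfC b T * (nodeRevPoly T).eval w := by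
  have hG := sum_dodgerWeight_div_eq hb T hw hw1
  have hΛ : (latticeRevPoly b T).eval w ≠ 0 := by
    rw [eval_latticeRevPoly]
    exact Finset.prod_ne_zero_iff.2 fun k _ => sub_ne_zero.2 (Ne.symm (hw1 k))
  -- multiply the generating identity by `Λ̃(w)`
  have hk : ∀ k : Fin (zetaZeroCount T), dodgerWeight b T k * (latticeRevPolyErase b T k).eval w =
      (latticeRevPoly b T).eval w * (dodgerWeight b T k / (1 - (((latticeFreq b (k.val + 1)) ^ 2 : ℝ) : ℂ) * w)) := by
    intro k
    have h1 : 1 - (((latticeFreq b (k.val + 1)) ^ 2 : ℝ) : ℂ) * w ≠ 0 := sub_ne_zero.2 (Ne.symm (hw1 k))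
    rw [latticeRevPoly_eq_mul b T k, eval_mul]
    have : ((1 - C (((latticeFreq b (k.val + 1)) ^ 2 : ℝ) : ℂ) * X : ℂ[X])).eval w =
        1 - (((latticeFreq b (k.val + 1)) ^ 2 : ℝ) : ℂ) * w := by simp
    rw [this]
    field_simp
  rw [Finset.sum_congr rfl fun k _ => hk k, ← Finset.mul_sum]
  unfold dodgerWeight
  rw [eval_latticeRevPoly] at hΛ
  rw [hG, eval_latticeRevPoly, eval_nodeRevPoly, dodgerCinfC, mul_sub, mul_one, ← mul_div_assoc, ← mul_div_assoc,
    mul_div_cancel_left₀ _ hΛ]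

/-- **The reversed Lagrange identity** in `ℂ[X]`: `Σ_k C(w_k)·Λ̃^{(k)} = Λ̃ − C(c_∞)·P̃`. [this track, ATTEMPT-18 §3 D1 (γ)] -/
theorem sum_C_dodgerWeight_mul_eq {b : ℝ} (hb : 0 < b) (T : ℝ) :
    ∑ k : Fin (zetaZeroCount T), C (dodgerWeight b T k) * latticeRevPolyErase b T k =
      latticeRevPoly b T - C (dodgerCinfC b T) * nodeRevPoly T := by
  apply Polynomial.eq_of_infinite_eval_eq
  -- the identity holds off the finite set `{0} ∪ {ν_k⁻¹}`
  set bad : Set ℂ := insert 0 (Set.range fun k : Fin (zetaZeroCount T) => ((((latticeFreq b (k.val + 1)) ^ 2 : ℝ) : ℂ))⁻¹) with hbad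
  have hfin : bad.Finite := (Set.finite_range _).insert 0
  refine (hfin.infinite_compl).mono fun w hw => ?_
  simp only [hbad, Set.mem_compl_iff, Set.mem_insert_iff, Set.mem_range, not_or, not_exists] at hw
  have hw0 : w ≠ 0 := hw.1
  have hw1 : ∀ k : Fin (zetaZeroCount T), (((latticeFreq b (k.val + 1)) ^ 2 : ℝ) : ℂ) * w ≠ 1 := by
    intro k h
    exact hw.2 k (inv_eq_of_mul_eq_one_right h)
  simp only [Set.mem_setOf_eq, eval_finsetSum, eval_mul, eval_C, eval_sub]
  exact sum_dodgerWeight_mul_eval hb T hw0 hw1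

/-! ## Coefficients -/

/-- The coefficients of `Λ̃^{(k)}`: `[Xⁿ]Λ̃^{(k)} = Σ_{i≤n} λ̃_i·ν_k^{n−i}` (from `Λ̃ = (1 − ν_kX)Λ̃^{(k)}`). [folklore] -/
theorem coeff_latticeRevPolyErase (b T : ℝ) (k : Fin (zetaZeroCount T)) (n : ℕ) :
    (latticeRevPolyErase b T k).coeff n =
      ∑ i ∈ Finset.range (n + 1), (latticeRevPoly b T).coeff i * (((latticeFreq b (k.val + 1)) ^ 2 : ℝ) : ℂ) ^ (n - i) := by
  set ν : ℂ := (((latticeFreq b (k.val + 1)) ^ 2 : ℝ) : ℂ) with hν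
  set Q := latticeRevPolyErase b T k with hQ
  -- `λ̃_i = Q_i − ν·Q_{i−1}`
  have hrel0 : (latticeRevPoly b T).coeff 0 = Q.coeff 0 := by
    rw [latticeRevPoly_eq_mul b T k, ← hQ, sub_mul, one_mul, coeff_sub, mul_assoc, coeff_C_mul, coeff_X_mul_zero,
      mul_zero, sub_zero]
  have hrel : ∀ i : ℕ, (latticeRevPoly b T).coeff (i + 1) = Q.coeff (i + 1) - ν * Q.coeff i := by
    intro i
    rw [latticeRevPoly_eq_mul b T k, ← hQ, sub_mul, one_mul, coeff_sub, mul_assoc, coeff_C_mul, coeff_X_mul]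
  induction n with
  | zero => simp [hrel0]
  | succ n ih =>
    rw [Finset.sum_range_succ, Nat.sub_self, pow_zero, mul_one, hrel n]
    have hs : ∑ i ∈ Finset.range (n + 1), (latticeRevPoly b T).coeff i * ν ^ (n + 1 - i) =
        ν * ∑ i ∈ Finset.range (n + 1), (latticeRevPoly b T).coeff i * ν ^ (n - i) := by
      rw [Finset.mul_sum]
      refine Finset.sum_congr rfl fun i hi => ?_
      have hi' : i ≤ n := Nat.lt_succ_iff.1 (Finset.mem_range.1 hi)
      rw [show n + 1 - i = (n - i) + 1 by omega, pow_succ]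
      ring
    rw [hs, ← ih]
    ring

/-- `λ̃_0 = 1`. [folklore] -/
theorem coeff_latticeRevPoly_zero (b T : ℝ) : (latticeRevPoly b T).coeff 0 = 1 := by
  rw [coeff_zero_eq_eval_zero, eval_latticeRevPoly]; simp

/-- `π̃_0 = 1`. [folklore] -/
theorem coeff_nodeRevPoly_zero (T : ℝ) : (nodeRevPoly T).coeff 0 = 1 := by
  rw [coeff_zero_eq_eval_zero, eval_nodeRevPoly]; simp

/-- **The moment recursion.** For every `n`: `Σ_{i≤n} λ̃_i·M_{n−i} = λ̃_n − c_∞·π̃_n`. [this track, ATTEMPT-18 §3 D1 roadmap (γ)] -/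
theorem dodgerMoment_recursion {b : ℝ} (hb : 0 < b) (T : ℝ) (n : ℕ) :
    ∑ i ∈ Finset.range (n + 1), (latticeRevPoly b T).coeff i * dodgerMoment b T (n - i) =
      (latticeRevPoly b T).coeff n - dodgerCinfC b T * (nodeRevPoly T).coeff n := by
  have h := congrArg (fun p : ℂ[X] => p.coeff n) (sum_C_dodgerWeight_mul_eq hb T)
  simp only [finsetSum_coeff, coeff_C_mul, coeff_sub] at h
  rw [← h]
  simp only [coeff_latticeRevPolyErase, dodgerMoment, Finset.mul_sum]
  rw [Finset.sum_comm]
  refine Finset.sum_congr rfl fun k _ => Finset.sum_congr rfl fun i _ => ?_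
  ring

/-- `M_0 = 1 − c_∞` (the edge identity, again). [this track, ATTEMPT-16 Lemma A2] -/
theorem dodgerMoment_zero {b : ℝ} (hb : 0 < b) (T : ℝ) : dodgerMoment b T 0 = 1 - dodgerCinfC b T := by
  have h := dodgerMoment_recursion hb T 0
  simp only [zero_add, Finset.sum_range_one, Nat.sub_self, coeff_latticeRevPoly_zero, coeff_nodeRevPoly_zero, one_mul,
    mul_one] at h
  exact h

/-! ## The first moment -/

/-- The `X¹`-coefficient of a product of powers of linear factors: `[X¹]Π_{i∈s}(1 − c_iX)^{m_i} = −Σ_{i∈s} m_ic_i`. [folklore] -/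
theorem coeff_one_prod_pow_linear {ι : Type*} [DecidableEq ι] (s : Finset ι) (c : ι → ℂ) (m : ι → ℕ) :
    (∏ i ∈ s, (1 - C (c i) * X) ^ m i).coeff 1 = -∑ i ∈ s, (m i : ℂ) * c i := by
  have h1 : (∏ i ∈ s, (1 - C (c i) * X) ^ m i).coeff 1 = (derivative (∏ i ∈ s, (1 - C (c i) * X) ^ m i)).coeff 0 := by
    rw [coeff_derivative]; simp
  rw [h1, derivative_prod_finset, finsetSum_coeff, ← Finset.sum_neg_distrib]
  refine Finset.sum_congr rfl fun i _ => ?_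
  rw [coeff_zero_eq_eval_zero, eval_mul, eval_prod, derivative_pow, derivative_sub, derivative_one, derivative_C_mul_X,
    zero_sub]
  simp

/-- `λ̃_1 = −Σ_kν_k`. [folklore] -/
theorem coeff_latticeRevPoly_one (b T : ℝ) :
    (latticeRevPoly b T).coeff 1 = -∑ k : Fin (zetaZeroCount T), (((latticeFreq b (k.val + 1)) ^ 2 : ℝ) : ℂ) := by
  have h := coeff_one_prod_pow_linear (univ : Finset (Fin (zetaZeroCount T)))
    (fun k => (((latticeFreq b (k.val + 1)) ^ 2 : ℝ) : ℂ)) (fun _ => 1)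
  simp only [pow_one, Nat.cast_one, one_mul] at h
  exact h

/-- `π̃_1 = −Σ_ρ m(ρ)z_ρ²`. [folklore] -/
theorem coeff_nodeRevPoly_one (T : ℝ) :
    (nodeRevPoly T).coeff 1 = -∑ ρ ∈ zerosBetween 0 T, ((riemannZetaZeroOrder ρ).toNat : ℂ) * dodgerNode ρ ^ 2 := by
  classical
  exact coeff_one_prod_pow_linear (zerosBetween 0 T) (fun ρ => dodgerNode ρ ^ 2) (fun ρ => (riemannZetaZeroOrder ρ).toNat)

/-- **The first moment**: `M_1 = c_∞·(Σ_ρ m(ρ)z_ρ² − Σ_kν_k) = c_∞·p₁` — the quadratic coefficient of the collar profile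
(`2b·Re F₀(b−σ) = c_∞(1 + p₁σ²/2 − …)`). [this track, ATTEMPT-16 Lemma A3; ATTEMPT-18 §3 D1] -/
theorem dodgerMoment_one {b : ℝ} (hb : 0 < b) (T : ℝ) :
    dodgerMoment b T 1 = dodgerCinfC b T *
      (∑ ρ ∈ zerosBetween 0 T, ((riemannZetaZeroOrder ρ).toNat : ℂ) * dodgerNode ρ ^ 2 -
        ∑ k : Fin (zetaZeroCount T), (((latticeFreq b (k.val + 1)) ^ 2 : ℝ) : ℂ)) := by
  have h := dodgerMoment_recursion hb T 1
  rw [Finset.sum_range_succ, Finset.sum_range_one, Nat.sub_zero, Nat.sub_self, dodgerMoment_zero hb T,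
    coeff_latticeRevPoly_zero, coeff_latticeRevPoly_one, coeff_nodeRevPoly_one, one_mul] at h
  linear_combination h

end Summit.RiemannHypothesis.RiemannHypothesis.Theorems.Handoff

end
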